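import Literature.Combinatorics.StablePolynomials.SzaszCoefficientBound
import Literature.NumberTheory.LFunctions.SatheSelbergProofs
import Mathlib.Analysis.SpecialFunctions.Stirling
import Mathlib.Algebra.Order.Antidiag.FinsuppEquiv
import Mathlib.Analysis.SpecificLimits.Normed
import HarnessLib

/-!
# The multivariate Szász principle: growth of stable polynomials (Borcea–Brändén I, Theorem 5.5)

J. Borcea, P. Brändén, *The Lee–Yang and Pólya–Schur programs. I. Linear operators preserving stability*,
Invent. Math. 177 (2009) 541–569 (arXiv:0809.0401), §5.2 "Multivariate Szász principles":

> **Theorem 5.5.** Suppose that the polynomial `f(z) = 1 + Σ_{|β|>0} a(β) z^β ∈ ℂ[z_1,…,z_n]` is stable and let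
> `B = 2^{n-1} √(2e²-e)/(e-1) = 2^{n-1} · 2.0210…`,
> `C = 6e² (Σ_{i=1}^n |a(e_i)|)² + 4e² Σ_{i,j=1}^n |a(e_i+e_j)|`.
> Then `max {|f(z)| : |z_i| ≤ r, 1 ≤ i ≤ n} ≤ B e^{C r²}`, `r ≥ 0`.
>
> *Proof.* We make use of the following simple inequalities that may be proved by induction or from
> Stirling estimates: `e^{-n} ≤ n!/nⁿ ≤ (en+1) e^{-n}`, `n ≥ 0`. Let `d(n,k) = Σ_{β ∈ ℕⁿ, |β|=k} β^β/β!` and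
> note that `|{β ∈ ℕⁿ : |β| = k}| = binom(n+k-1, k)`. By (Stirling) we have the (rough) estimate
> `d(n,k) ≤ binom(n+k-1,k) e^k ≤ 2^{n-1+k} e^k`. Let `A` be as in Lemma 5.4 and apply the same lemma:
> `max{|f(z)| : |z_i| ≤ r} ≤ Σ_β |β|^{-|β|/2} (β^β/β!) (Ar)^{|β|} = Σ_k d(n,k) k^{-k/2} (Ar)^k
> ≤ 2^{n-1} Σ_k k^{-k/2} (2eAr)^k`. Set `R = 2eAr`. By (Stirling) and the Cauchy–Schwarz inequality we get
> `Σ_k k^{-k/2} R^k ≤ Σ_k √((ek+1)e^{-k}) √(R^{2k}/k!) ≤ √(Σ_k (ek+1)e^{-k}) √(Σ_k R^{2k}/k!)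
> = (√(2e²-e)/(e-1)) e^{R²/2}`, which combined with the previous bound proves the theorem. □

This file proves Theorem 5.5 following the printed argument step by step, on top of the tree's
Lemma 5.4 (`BorceaBranden_lemma_5_4`, `SzaszCoefficientBound.lean`; `A² = szaszA f`):

* §1 the Stirling-type inequalities `e^{-n} ≤ n!/nⁿ ≤ (en+1)e^{-n}` (the upper one from the tree's
  Stirling bound `n! ≤ e√n (n/e)ⁿ`, `SatheSelberg.factorial_le_stirling_upper` in
  `Literature/NumberTheory/LFunctions/SatheSelbergProofs.lean` — imported for that lemma only — which
  rests on Mathlib's monotone Stirling sequence `Stirling.stirlingSeq'_antitone`), and `β^β/β! ≤ e^{|β|}`;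
* §2 stars and bars `|{β : |β| = k}| = binom(n+k-1,k)` (Mathlib's `Finset.card_finsuppAntidiag_nat_eq_choose`)
  and the estimate `d(n,k) ≤ binom(n+k-1,k) e^k`, `binom(n+k-1,k) ≤ 2^{n-1+k}`;
* §3 the series `Σ_k (ek+1) e^{-k} = (2e²-e)/(e-1)²` and the Cauchy–Schwarz step
  `Σ_{k<K} k^{-k/2} R^k ≤ (√(2e²-e)/(e-1)) e^{R²/2}` (`Σ_{k<K} R^{2k}/k! ≤ e^{R²}`, `Real.sum_le_exp_of_nonneg`);
* §4 **`BorceaBranden_szaszGrowthBound`** — Theorem 5.5: for `|z_i| ≤ r`,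
  `|f(z)| ≤ 2^{n-1} (√(2e²-e)/(e-1)) e^{C r²}` with `C = szaszC f` the printed constant
  (`szaszC_eq : C = 2e² A²`).

The maximum over the closed polydisc is expressed pointwise (`∀ z, (∀ i, ‖z i‖ ≤ r) → …`). The factor
`2^{n-1}` is written as the natural power `2 ^ (n - 1)`; for `n ≥ 1` variables this is the printed constant
(for `n = 0`, where `f = 1`, truncated subtraction gives the harmless constant `2.02…`).

## References

* [BorceaBranden2009] J. Borcea, P. Brändén, Invent. Math. 177 (2009) 541–569, §5.2 Theorem 5.5 and its proof
  (inequalities (5.3)–(5.5)); Lemma 5.4 (`SzaszCoefficientBound.lean`).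
-/

noncomputable section

open MvPolynomial Finset

namespace Literature.Combinatorics.StablePolynomials

/-! ## §1 Stirling-type inequalities -/

section Stirling

/-- `mᵐ/m! ≤ eᵐ` (the lower inequality `e^{-n} ≤ n!/nⁿ` of the printed proof, from `xᵐ/m! ≤ eˣ`).
[cite: BorceaBranden2009, §5.2 proof of Thm. 5.5, inequality (Stirling) `e^{-n} ≤ n!/n^n`] -/
theorem pow_self_div_factorial_le_exp (m : ℕ) : (m : ℝ) ^ m / (m.factorial : ℝ) ≤ Real.exp m :=
  Real.pow_div_factorial_le_exp (m : ℝ) (Nat.cast_nonneg m) m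

/-- `e^{-n} ≤ n!/nⁿ`. [cite: BorceaBranden2009, §5.2 proof of Thm. 5.5, inequality (Stirling), left half] -/
theorem exp_neg_le_factorial_div_pow_self (m : ℕ) :
    Real.exp (-(m : ℝ)) ≤ (m.factorial : ℝ) / (m : ℝ) ^ m := by
  have hpow : (0 : ℝ) < (m : ℝ) ^ m := by
    rcases Nat.eq_zero_or_pos m with rfl | hm
    · norm_num
    · exact pow_pos (Nat.cast_pos.2 hm) _
  rw [le_div_iff₀ hpow, Real.exp_neg, inv_mul_le_iff₀ (Real.exp_pos _)]
  have h := pow_self_div_factorial_le_exp m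
  rwa [div_le_iff₀ (Nat.cast_pos.2 (Nat.factorial_pos m))] at h

/-- `β^β/β! ≤ e^{|β|}` for `β ∈ ℕⁿ` (`β^β = Π βᵢ^{βᵢ}`, `β! = Π βᵢ!`). [cite: BorceaBranden2009, §5.2 proof of
Thm. 5.5 ("By (Stirling) we have the following (rough) estimate")] -/
theorem prod_pow_self_div_prod_factorial_le_exp {τ : Type*} [Fintype τ] (β : τ → ℕ) :
    (∏ i, (β i : ℝ) ^ β i) / ∏ i, ((β i).factorial : ℝ) ≤ Real.exp ((∑ i, β i : ℕ) : ℝ) := by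
  rw [← Finset.prod_div_distrib, Nat.cast_sum, Real.exp_sum]
  exact Finset.prod_le_prod (fun i _ => div_nonneg (pow_nonneg (Nat.cast_nonneg _) _) (Nat.cast_nonneg _))
    fun i _ => pow_self_div_factorial_le_exp (β i)

/-- `√x ^ k = √(x ^ k)` for `x ≥ 0`. [folklore] -/
private theorem sqrt_pow_eq_sqrt_pow {x : ℝ} (hx : 0 ≤ x) (k : ℕ) : Real.sqrt x ^ k = Real.sqrt (x ^ k) := by
  rw [show x ^ k = (Real.sqrt x ^ k) ^ 2 by rw [← pow_mul, mul_comm, pow_mul, Real.sq_sqrt hx],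
    Real.sqrt_sq (pow_nonneg (Real.sqrt_nonneg x) k)]

/-- `n!/nⁿ ≤ (en+1) e^{-n}` in the form `(kᵏ)⁻¹ ≤ (ek+1) e^{-k}/k!` (all `k ≥ 0`): from the Stirling upper
bound `k! ≤ e√k (k/e)ᵏ` (`SatheSelberg.factorial_le_stirling_upper`) and `e√k ≤ ek + 1`.
[cite: BorceaBranden2009, §5.2 proof of Thm. 5.5, inequality (Stirling), right half ("may be proved by
induction or from Stirling estimates")] -/
theorem inv_pow_self_le (k : ℕ) :
    ((k : ℝ) ^ k)⁻¹ ≤ (Real.exp 1 * k + 1) * Real.exp (-1) ^ k / k.factorial := by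
  rcases Nat.eq_zero_or_pos k with rfl | hk
  · norm_num
  have hk' : (0 : ℝ) < k := Nat.cast_pos.2 hk
  have hfac : (0 : ℝ) < k.factorial := Nat.cast_pos.2 (Nat.factorial_pos k)
  rw [le_div_iff₀ hfac]
  calc ((k : ℝ) ^ k)⁻¹ * k.factorial
      ≤ ((k : ℝ) ^ k)⁻¹ * (Real.exp 1 * Real.sqrt k * ((k : ℝ) / Real.exp 1) ^ k) :=
        mul_le_mul_of_nonneg_left (Literature.NumberTheory.LFunctions.SatheSelberg.factorial_le_stirling_upper hk)
          (inv_nonneg.2 (pow_nonneg hk'.le _))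
    _ = Real.exp 1 * Real.sqrt k * Real.exp (-1) ^ k := by
        rw [div_pow, Real.exp_neg, inv_pow]
        field_simp
    _ ≤ (Real.exp 1 * k + 1) * Real.exp (-1) ^ k := by
        apply mul_le_mul_of_nonneg_right _ (pow_nonneg (Real.exp_nonneg _) _)
        have h1 : Real.sqrt (k : ℝ) ≤ k :=
          Real.sqrt_le_iff.2 ⟨hk'.le, by nlinarith [show (1 : ℝ) ≤ k from Nat.one_le_cast.2 hk]⟩
        nlinarith [Real.exp_pos 1, Real.sqrt_nonneg (k : ℝ)]

/-- `n!/nⁿ ≤ (en+1) e^{-n}`. [cite: BorceaBranden2009, §5.2 proof of Thm. 5.5, inequality (Stirling), right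
half] -/
theorem factorial_div_pow_self_le (m : ℕ) :
    (m.factorial : ℝ) / (m : ℝ) ^ m ≤ (Real.exp 1 * m + 1) * Real.exp (-(m : ℝ)) := by
  have h := inv_pow_self_le m
  have hfac : (0 : ℝ) < m.factorial := Nat.cast_pos.2 (Nat.factorial_pos m)
  rw [le_div_iff₀ hfac] at h
  rw [show Real.exp (-(m : ℝ)) = Real.exp (-1) ^ m by rw [← Real.exp_nat_mul, mul_neg, mul_one],
    div_eq_mul_inv, mul_comm]
  exact h

end Stirling

/-! ## §2 Stars and bars and the estimate for `d(n,k)` -/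

section Counting

variable {τ : Type*} [Fintype τ] [DecidableEq τ]

/-- **Stars and bars**: `|{β ∈ ℕⁿ : |β| = k}| = binom(n+k-1, k)`. [cite: BorceaBranden2009, §5.2 proof of
Thm. 5.5 ("note that `|{β ∈ ℕⁿ : |β| = k}| = binom(n+k-1,k)`")] -/
theorem card_finsuppAntidiag_univ (k : ℕ) :
    #((Finset.univ : Finset τ).finsuppAntidiag k) = (Fintype.card τ + k - 1).choose k := by
  rw [Finset.card_finsuppAntidiag_nat_eq_choose, Finset.card_univ]

/-- The exponent vectors of total degree `k` in any finite set number at most `binom(n+k-1,k)`.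
[cite: BorceaBranden2009, §5.2 proof of Thm. 5.5 (the count `binom(n+k-1,k)`)] -/
theorem card_filter_degree_le (S : Finset (τ →₀ ℕ)) (k : ℕ) :
    #{β ∈ S | ∑ i, β i = k} ≤ (Fintype.card τ + k - 1).choose k := by
  rw [← card_finsuppAntidiag_univ]
  refine Finset.card_le_card fun β hβ => ?_
  rw [Finset.mem_filter] at hβ
  exact Finset.mem_finsuppAntidiag.2 ⟨hβ.2, Finset.subset_univ _⟩

/-- **`d(n,k) ≤ binom(n+k-1,k) eᵏ`** where `d(n,k) = Σ_{|β|=k} β^β/β!`. [cite: BorceaBranden2009, §5.2 proof of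
Thm. 5.5, the (rough) estimate for `d(n,k)`] -/
theorem sum_pow_self_div_factorial_le (k : ℕ) :
    ∑ β ∈ (Finset.univ : Finset τ).finsuppAntidiag k, (∏ i, (β i : ℝ) ^ β i) / ∏ i, ((β i).factorial : ℝ) ≤
      ((Fintype.card τ + k - 1).choose k : ℝ) * Real.exp k := by
  rw [← card_finsuppAntidiag_univ, ← nsmul_eq_mul, ← Finset.sum_const]
  refine Finset.sum_le_sum fun β hβ => ?_
  have hk : (∑ i, β i : ℕ) = k := (Finset.mem_finsuppAntidiag.1 hβ).1
  have h := prod_pow_self_div_prod_factorial_le_exp (⇑β)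
  rwa [hk] at h

/-- `binom(n+k-1, k) ≤ 2^{n-1+k} ≤ 2^{n-1} 2ᵏ`. [cite: BorceaBranden2009, §5.2 proof of Thm. 5.5 (the estimate
`binom(n+k-1,k) e^k ≤ 2^{n-1+k} e^k`)] -/
theorem choose_le_two_pow_mul_two_pow (n k : ℕ) :
    ((n + k - 1).choose k : ℝ) ≤ 2 ^ (n - 1) * 2 ^ k := by
  calc ((n + k - 1).choose k : ℝ) ≤ 2 ^ (n + k - 1) := by exact_mod_cast Nat.choose_le_two_pow (n + k - 1) k
    _ ≤ 2 ^ (n - 1 + k) := pow_le_pow_right₀ one_le_two (by omega)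
    _ = 2 ^ (n - 1) * 2 ^ k := pow_add _ _ _

end Counting

/-! ## §3 The series `Σ (ek+1)e^{-k}` and the Cauchy–Schwarz step -/

section Series

/-- **`Σ_{k≥0} (ek+1) e^{-k} = (2e²-e)/(e-1)²`** (so that `√(Σ (ek+1)e^{-k}) = √(2e²-e)/(e-1) = 2.0210…`).
[cite: BorceaBranden2009, §5.2 Thm. 5.5 (the constant `B`) and its proof (last display)] -/
theorem hasSum_exp_mul_add_one_mul_exp_neg :
    HasSum (fun k : ℕ => (Real.exp 1 * k + 1) * Real.exp (-1) ^ k)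
      ((2 * Real.exp 2 - Real.exp 1) / (Real.exp 1 - 1) ^ 2) := by
  have he1 : 1 < Real.exp 1 := Real.one_lt_exp_iff.2 one_pos
  have hx0 : 0 ≤ Real.exp (-1) := Real.exp_nonneg _
  have hx1 : Real.exp (-1) < 1 := Real.exp_lt_one_iff.2 (by norm_num)
  have h1 : HasSum (fun k : ℕ => (k : ℝ) * Real.exp (-1) ^ k) (Real.exp (-1) / (1 - Real.exp (-1)) ^ 2) :=
    hasSum_coe_mul_geometric_of_norm_lt_one (by rwa [Real.norm_of_nonneg hx0])
  have h2 : HasSum (fun k : ℕ => Real.exp (-1) ^ k) (1 - Real.exp (-1))⁻¹ := hasSum_geometric_of_lt_one hx0 hx1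
  have h3 : HasSum (fun k : ℕ => Real.exp 1 * ((k : ℝ) * Real.exp (-1) ^ k) + Real.exp (-1) ^ k)
      (Real.exp 1 * (Real.exp (-1) / (1 - Real.exp (-1)) ^ 2) + (1 - Real.exp (-1))⁻¹) :=
    (h1.mul_left (Real.exp 1)).add h2
  have hfun : (fun k : ℕ => (Real.exp 1 * k + 1) * Real.exp (-1) ^ k) =
      fun k : ℕ => Real.exp 1 * ((k : ℝ) * Real.exp (-1) ^ k) + Real.exp (-1) ^ k :=
    funext fun k => by ring
  have hval : (2 * Real.exp 2 - Real.exp 1) / (Real.exp 1 - 1) ^ 2 =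
      Real.exp 1 * (Real.exp (-1) / (1 - Real.exp (-1)) ^ 2) + (1 - Real.exp (-1))⁻¹ := by
    have he2 : Real.exp 2 = Real.exp 1 * Real.exp 1 := by rw [← Real.exp_add]; norm_num
    have hne : Real.exp 1 - 1 ≠ 0 := (sub_pos.2 he1).ne'
    have hne' : Real.exp 1 ≠ 0 := (Real.exp_pos 1).ne'
    rw [he2, Real.exp_neg]
    field_simp
    ring
  rw [hfun, hval]
  exact h3

/-- **The Cauchy–Schwarz step**: for `R ≥ 0` and every `K`,
`Σ_{k<K} k^{-k/2} Rᵏ ≤ Σ_{k<K} √((ek+1)e^{-k}) √(R^{2k}/k!) ≤ √(Σ(ek+1)e^{-k}) √(Σ R^{2k}/k!) ≤ (√(2e²-e)/(e-1)) e^{R²/2}`.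
[cite: BorceaBranden2009, §5.2 proof of Thm. 5.5 (last display: "By (Stirling) and the Cauchy–Schwarz
inequality")] -/
theorem sum_sqrt_inv_pow_self_mul_pow_le (K : ℕ) {R : ℝ} (hR : 0 ≤ R) :
    ∑ k ∈ Finset.range K, Real.sqrt (((k : ℝ) ^ k)⁻¹) * R ^ k ≤
      Real.sqrt (2 * Real.exp 2 - Real.exp 1) / (Real.exp 1 - 1) * Real.exp (R ^ 2 / 2) := by
  set p : ℕ → ℝ := fun k => (Real.exp 1 * k + 1) * Real.exp (-1) ^ k with hp_def
  set q : ℕ → ℝ := fun k => (R ^ 2) ^ k / (k.factorial : ℝ) with hq_def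
  have hp : ∀ k, 0 ≤ p k := fun k => by positivity
  have hq : ∀ k, 0 ≤ q k := fun k => by positivity
  have hterm : ∀ k : ℕ, Real.sqrt (((k : ℝ) ^ k)⁻¹) * R ^ k ≤ Real.sqrt (p k) * Real.sqrt (q k) := by
    intro k
    rw [← Real.sqrt_mul (hp k), show R ^ k = Real.sqrt ((R ^ 2) ^ k) by
      rw [← pow_mul, mul_comm, pow_mul, Real.sqrt_sq (pow_nonneg hR _)],
      ← Real.sqrt_mul (inv_nonneg.2 (pow_nonneg (Nat.cast_nonneg _) _))]
    refine Real.sqrt_le_sqrt ?_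
    calc ((k : ℝ) ^ k)⁻¹ * (R ^ 2) ^ k
        ≤ ((Real.exp 1 * k + 1) * Real.exp (-1) ^ k / k.factorial) * (R ^ 2) ^ k :=
          mul_le_mul_of_nonneg_right (inv_pow_self_le k) (pow_nonneg (sq_nonneg _) _)
      _ = p k * q k := by
          simp only [hp_def, hq_def]
          ring
  have he1 : 1 ≤ Real.exp 1 := (Real.one_lt_exp_iff.2 one_pos).le
  calc ∑ k ∈ Finset.range K, Real.sqrt (((k : ℝ) ^ k)⁻¹) * R ^ k
      ≤ ∑ k ∈ Finset.range K, Real.sqrt (p k) * Real.sqrt (q k) := Finset.sum_le_sum fun k _ => hterm k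
    _ ≤ Real.sqrt (∑ k ∈ Finset.range K, p k) * Real.sqrt (∑ k ∈ Finset.range K, q k) :=
        Real.sum_sqrt_mul_sqrt_le _ hp hq
    _ ≤ Real.sqrt ((2 * Real.exp 2 - Real.exp 1) / (Real.exp 1 - 1) ^ 2) * Real.sqrt (Real.exp (R ^ 2)) :=
        mul_le_mul (Real.sqrt_le_sqrt (sum_le_hasSum _ (fun k _ => hp k) hasSum_exp_mul_add_one_mul_exp_neg))
          (Real.sqrt_le_sqrt (Real.sum_le_exp_of_nonneg (sq_nonneg R) K)) (Real.sqrt_nonneg _)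
          (Real.sqrt_nonneg _)
    _ = Real.sqrt (2 * Real.exp 2 - Real.exp 1) / (Real.exp 1 - 1) * Real.exp (R ^ 2 / 2) := by
        rw [Real.sqrt_div' _ (sq_nonneg _), Real.sqrt_sq (sub_nonneg.2 he1),
          show Real.exp (R ^ 2) = Real.exp (R ^ 2 / 2) ^ 2 by rw [← Real.exp_nat_mul]; ring_nf,
          Real.sqrt_sq (Real.exp_nonneg _)]

end Series

/-! ## §4 Theorem 5.5 -/

section Growth

variable {τ : Type*} [Fintype τ]

/-- **The constant `C = 6e²(Σ_i |a(e_i)|)² + 4e² Σ_{i,j} |a(e_i+e_j)|`** of Theorem 5.5.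
[cite: BorceaBranden2009, §5.2 Thm. 5.5 (the constant `C`)] -/
def szaszC (f : MvPolynomial τ ℂ) : ℝ :=
  6 * Real.exp 2 * (∑ i, ‖coeff (Finsupp.single i 1) f‖) ^ 2 +
    4 * Real.exp 2 * ∑ i, ∑ j, ‖coeff (Finsupp.single i 1 + Finsupp.single j 1) f‖

/-- `C = 2e² A²` with `A` the constant of Lemma 5.4 (`R²/2 = C r²` for `R = 2eAr`). [cite: BorceaBranden2009, §5.2
Thm. 5.5 and Lemma 5.4 (the constants `C` and `A`)] -/
theorem szaszC_eq (f : MvPolynomial τ ℂ) : szaszC f = 2 * Real.exp 2 * szaszA f := by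
  unfold szaszC szaszA
  ring

/-- `C ≥ 0`. [cite: BorceaBranden2009, §5.2 Thm. 5.5 (the constant `C`)] -/
theorem szaszC_nonneg (f : MvPolynomial τ ℂ) : 0 ≤ szaszC f := by
  rw [szaszC_eq]
  exact mul_nonneg (mul_nonneg zero_le_two (Real.exp_nonneg _)) (szaszA_nonneg f)

/-- **Step 1**: on the polydisc `|z_i| ≤ r`, `|f(z)| ≤ Σ_{β ∈ supp f} |a(β)| r^{|β|}`. [cite: BorceaBranden2009,
§5.2 proof of Thm. 5.5, first line of display (5.5)] -/
theorem norm_eval_le_sum_support (f : MvPolynomial τ ℂ) {r : ℝ} (z : τ → ℂ) (hz : ∀ i, ‖z i‖ ≤ r) :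
    ‖eval z f‖ ≤ ∑ β ∈ f.support, ‖coeff β f‖ * r ^ (∑ i, β i) := by
  rw [eval_eq']
  refine (norm_sum_le _ _).trans (Finset.sum_le_sum fun β _ => ?_)
  rw [norm_mul, norm_prod, ← Finset.prod_pow_eq_pow_sum]
  refine mul_le_mul_of_nonneg_left (Finset.prod_le_prod (fun i _ => norm_nonneg _) fun i _ => ?_)
    (norm_nonneg _)
  rw [norm_pow]
  exact pow_le_pow_left₀ (norm_nonneg _) (hz i) _

/-- **Step 2** (Lemma 5.4 and `β^β/β! ≤ e^{|β|}`): `|a(β)| r^{|β|} ≤ e^{|β|} (A/√|β|)^{|β|} r^{|β|}`.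
[cite: BorceaBranden2009, §5.2 proof of Thm. 5.5 ("Let `A` be as in Lemma 5.4 and apply the same lemma")] -/
theorem norm_coeff_mul_pow_le [DecidableEq τ] {f : MvPolynomial τ ℂ} (hf : IsUpperHalfPlaneStable f)
    (h0 : coeff 0 f = 1) {r : ℝ} (hr : 0 ≤ r) (β : τ →₀ ℕ) :
    ‖coeff β f‖ * r ^ (∑ i, β i) ≤
      Real.exp ((∑ i, β i : ℕ) : ℝ) * Real.sqrt (szaszA f / (∑ i, β i : ℕ)) ^ (∑ i, β i) * r ^ (∑ i, β i) := by
  have h := BorceaBranden_lemma_5_4 hf h0 ⇑β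
  rw [toF_coe] at h
  refine mul_le_mul_of_nonneg_right (h.trans ?_) (pow_nonneg hr _)
  exact mul_le_mul_of_nonneg_right (prod_pow_self_div_prod_factorial_le_exp ⇑β)
    (pow_nonneg (Real.sqrt_nonneg _) _)

/-- **Step 3** (grouping by `k = |β|` and stars and bars): for non-negative weights `W`,
`Σ_{β ∈ supp f} W(|β|) ≤ Σ_{k ≤ deg f} binom(n+k-1,k) W(k)`. [cite: BorceaBranden2009, §5.2 proof of Thm. 5.5
("`= Σ_k d(n,k) k^{-k/2} (Ar)^k`")] -/
theorem sum_support_le_sum_range [DecidableEq τ] (f : MvPolynomial τ ℂ) (W : ℕ → ℝ) (hW : ∀ k, 0 ≤ W k) :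
    ∑ β ∈ f.support, W (∑ i, β i) ≤
      ∑ k ∈ Finset.range (f.totalDegree + 1), ((Fintype.card τ + k - 1).choose k : ℝ) * W k := by
  have hmaps : ∀ β ∈ f.support, (∑ i, β i) ∈ Finset.range (f.totalDegree + 1) := fun β hβ => by
    rw [Finset.mem_range, Nat.lt_succ_iff]
    have h := le_totalDegree hβ
    rwa [Finsupp.sum_fintype _ _ (fun _ => rfl)] at h
  rw [← Finset.sum_fiberwise_of_maps_to hmaps]
  refine Finset.sum_le_sum fun k _ => ?_
  rw [Finset.sum_congr rfl fun β hβ => by rw [(Finset.mem_filter.1 hβ).2], Finset.sum_const, nsmul_eq_mul]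
  exact mul_le_mul_of_nonneg_right (Nat.cast_le.2 (card_filter_degree_le f.support k)) (hW k)

/-- **Borcea–Brändén I, Theorem 5.5 (multivariate Szász principle, growth bound).** If
`f(z) = 1 + Σ_{|β|>0} a(β) z^β ∈ ℂ[z_1,…,z_n]` is stable then, for every `r ≥ 0` and every `z` with
`|z_i| ≤ r` (`1 ≤ i ≤ n`), `|f(z)| ≤ B e^{C r²}` with `B = 2^{n-1} √(2e²-e)/(e-1)` and
`C = 6e²(Σ_i |a(e_i)|)² + 4e² Σ_{i,j} |a(e_i+e_j)|` (`szaszC f`). [cite: BorceaBranden2009, §5.2 Thm. 5.5] -/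
theorem BorceaBranden_szaszGrowthBound [DecidableEq τ] {f : MvPolynomial τ ℂ} (hf : IsUpperHalfPlaneStable f)
    (h0 : coeff 0 f = 1) {r : ℝ} (hr : 0 ≤ r) (z : τ → ℂ) (hz : ∀ i, ‖z i‖ ≤ r) :
    ‖eval z f‖ ≤ 2 ^ (Fintype.card τ - 1) * (Real.sqrt (2 * Real.exp 2 - Real.exp 1) / (Real.exp 1 - 1)) *
      Real.exp (szaszC f * r ^ 2) := by
  set n := Fintype.card τ with hn
  have hA2 : 0 ≤ szaszA f := szaszA_nonneg f
  set R : ℝ := 2 * Real.exp 1 * Real.sqrt (szaszA f) * r with hRdef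
  have hR : 0 ≤ R := by positivity
  set W : ℕ → ℝ := fun k => Real.exp (k : ℝ) * Real.sqrt (szaszA f / k) ^ k * r ^ k with hW
  have hW0 : ∀ k, 0 ≤ W k := fun k => by positivity
  -- Steps 1–2: `|f(z)| ≤ Σ_{β ∈ supp f} W(|β|)`
  have h1 : ‖eval z f‖ ≤ ∑ β ∈ f.support, W (∑ i, β i) :=
    (norm_eval_le_sum_support f z hz).trans (Finset.sum_le_sum fun β _ => norm_coeff_mul_pow_le hf h0 hr β)
  -- Step 3: `≤ Σ_k binom(n+k-1,k) W(k)`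
  have h2 := sum_support_le_sum_range f W hW0
  -- Step 4: `binom(n+k-1,k) W(k) ≤ 2^{n-1} k^{-k/2} R^k`, `R = 2eAr`
  have h3 : ∀ k : ℕ, ((n + k - 1).choose k : ℝ) * W k ≤
      2 ^ (n - 1) * (Real.sqrt (((k : ℝ) ^ k)⁻¹) * R ^ k) := by
    intro k
    have hWk : 2 ^ k * W k = Real.sqrt (((k : ℝ) ^ k)⁻¹) * R ^ k := by
      simp only [hW, hRdef]
      rw [show Real.exp (k : ℝ) = Real.exp 1 ^ k by rw [← Real.exp_nat_mul, mul_one],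
        Real.sqrt_div' _ (Nat.cast_nonneg k), div_pow, sqrt_pow_eq_sqrt_pow (Nat.cast_nonneg k) k,
        Real.sqrt_inv, mul_pow, mul_pow, mul_pow]
      ring
    calc ((n + k - 1).choose k : ℝ) * W k ≤ (2 ^ (n - 1) * 2 ^ k) * W k :=
          mul_le_mul_of_nonneg_right (choose_le_two_pow_mul_two_pow n k) (hW0 k)
      _ = 2 ^ (n - 1) * (2 ^ k * W k) := mul_assoc _ _ _
      _ = 2 ^ (n - 1) * (Real.sqrt (((k : ℝ) ^ k)⁻¹) * R ^ k) := by rw [hWk]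
  -- Step 5: Cauchy–Schwarz
  have h4 : ∑ k ∈ Finset.range (f.totalDegree + 1), ((n + k - 1).choose k : ℝ) * W k ≤
      2 ^ (n - 1) * (Real.sqrt (2 * Real.exp 2 - Real.exp 1) / (Real.exp 1 - 1) * Real.exp (R ^ 2 / 2)) := by
    calc ∑ k ∈ Finset.range (f.totalDegree + 1), ((n + k - 1).choose k : ℝ) * W k
        ≤ ∑ k ∈ Finset.range (f.totalDegree + 1), 2 ^ (n - 1) * (Real.sqrt (((k : ℝ) ^ k)⁻¹) * R ^ k) :=
          Finset.sum_le_sum fun k _ => h3 k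
      _ = 2 ^ (n - 1) * ∑ k ∈ Finset.range (f.totalDegree + 1), Real.sqrt (((k : ℝ) ^ k)⁻¹) * R ^ k := by
          rw [Finset.mul_sum]
      _ ≤ _ := mul_le_mul_of_nonneg_left (sum_sqrt_inv_pow_self_mul_pow_le _ hR) (pow_nonneg zero_le_two _)
  -- `R²/2 = C r²`
  have h5 : R ^ 2 / 2 = szaszC f * r ^ 2 := by
    rw [szaszC_eq, hRdef, mul_pow, mul_pow, mul_pow, Real.sq_sqrt hA2,
      show Real.exp 1 ^ 2 = Real.exp 2 by rw [← Real.exp_nat_mul]; norm_num]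
    ring
  calc ‖eval z f‖ ≤ _ := h1
    _ ≤ _ := h2
    _ ≤ _ := h4
    _ = _ := by rw [h5]; ring

/-- **Theorem 5.5 with the constants of Lemma 5.4**: `|f(z)| ≤ 2^{n-1} (√(2e²-e)/(e-1)) e^{2e²A²r²}` on
`|z_i| ≤ r`. [cite: BorceaBranden2009, §5.2 Thm. 5.5 and its proof (`R = 2eAr`, `e^{R²/2}`)] -/
theorem BorceaBranden_szaszGrowthBound' [DecidableEq τ] {f : MvPolynomial τ ℂ} (hf : IsUpperHalfPlaneStable f)
    (h0 : coeff 0 f = 1) {r : ℝ} (hr : 0 ≤ r) (z : τ → ℂ) (hz : ∀ i, ‖z i‖ ≤ r) :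
    ‖eval z f‖ ≤ 2 ^ (Fintype.card τ - 1) * (Real.sqrt (2 * Real.exp 2 - Real.exp 1) / (Real.exp 1 - 1)) *
      Real.exp (2 * Real.exp 2 * szaszA f * r ^ 2) := by
  rw [← szaszC_eq]
  exact BorceaBranden_szaszGrowthBound hf h0 hr z hz

end Growth

end Literature.Combinatorics.StablePolynomials

end
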